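import Summits.ABC.ABC.Theorems.RibetTakahashiSplitFewPrimeValuationProductStubDecisivePrimeBootstrapShape
import Literature.NumberTheory.DiophantineGeometry.AbcWave0QualityFormProofs
import HarnessLib

/-!
# Non-face triples from the hard core

Helper (`--supports`) for the line `matveev-face-clearing` of the crux
`Summit.ABC.ABC.Theses.RibetTakahashiSplit.FewPrimeValuationProduct` (stmt-ABC-1563): the
registered stub `stub_nonfaceOfHardCore`.

An abc triple `a + b = c` supported on `≤ 4` primes, no member of which is a power of two, has
the rigid shape `{a, b, c} = {ℓ^x, P^y, 2^k Q^z}` (up to which member is even) with `ℓ, P, Q`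
distinct odd primes and `x, y, z, k ≥ 1` (`decisivePrimeBootstrap_shape`,
`decisivePrimeBootstrap_member_eq`); moreover `∏_{p ∣ abc} v_p(abc) = x·y·z·k`
(`decisivePrimeBootstrap_prod_factorization_eq`) and `rad(abc) = 2ℓPQ`. Hence such a triple is a
solution of `±p^x ± q^y ± 2^k r^z = 0` in distinct odd primes, and the hard-core bound
`x·y·z·k ≤ C_ε (2pqr)^ε` is exactly the valuation-product bound
`∏_{p ∣ abc} v_p(abc) ≤ C_ε rad(abc)^ε` on non-face triples:

* `nonface_rad_eq` — `rad(abc) = 2ℓPQ` when `(abc).primeFactors = {2, ℓ, P, Q}`;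
* `nonface_hardCore_shape` — a non-face triple on `≤ 4` primes as a hard-core solution, with the
  valuation product and the radical identified;
* `stub_nonfaceOfHardCore` — the registered stub.
-/

-- `Summit.ABC.ABC` is the mandated summit-side namespace (CONVENTIONS §2); the duplicate is
-- deliberate.
set_option linter.dupNamespace false

noncomputable section

namespace Summit.ABC.ABC.Theorems.FewPrimeValuationProduct

open Finset
open Literature.NumberTheory.DiophantineGeometry

/-! ## The shape of a non-face triple as a hard-core solution -/

/-- In `ℕ` the radical `rad a b c` is the product of the prime factors of `abc`; with
`(abc).primeFactors = {2, ℓ, P, Q}` (pairwise distinct) it is `2ℓPQ`. `[folklore]` -/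
theorem nonface_rad_eq {a b c ℓ P Q : ℕ} (heq : (a * b * c).primeFactors = {2, ℓ, P, Q})
    (hℓ2 : ℓ ≠ 2) (hP2 : P ≠ 2) (hQ2 : Q ≠ 2) (hℓP : ℓ ≠ P) (hℓQ : ℓ ≠ Q) (hPQ : P ≠ Q) :
    rad a b c = 2 * ℓ * P * Q := by
  rw [rad_def, Nat.radical_eq_prod_primeFactors, heq, Finset.prod_insert, Finset.prod_insert,
    Finset.prod_pair hPQ]
  · ring
  all_goals simp only [Finset.mem_insert, Finset.mem_singleton]; omega

/-- **A non-face triple on `≤ 4` primes is a hard-core solution.** For an abc triple `a + b = c`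
with `≤ 4` prime factors, no member of which is a power of two, there are pairwise distinct odd
primes `p, q, r` and exponents `x, y, z, k ≥ 1` with `p^x + q^y = 2^k r^z` (`c` even),
`p^x + 2^k r^z = q^y` (`b` even) or `q^y + 2^k r^z = p^x` (`a` even), such that
`∏_{s ∣ abc} v_s(abc) = x·y·z·k` and `rad(abc) = 2pqr`. `[folklore]` -/
theorem nonface_hardCore_shape {a b c : ℕ} (h : IsABCTriple a b c)
    (hcard : (a * b * c).primeFactors.card ≤ 4)
    (hface : ¬ ((∃ j : ℕ, a = 2 ^ j) ∨ (∃ j : ℕ, b = 2 ^ j) ∨ (∃ j : ℕ, c = 2 ^ j))) :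
    ∃ p q r x y z k : ℕ, p.Prime ∧ q.Prime ∧ r.Prime ∧ Odd p ∧ Odd q ∧ Odd r ∧ p ≠ q ∧ p ≠ r ∧
      q ≠ r ∧ 0 < x ∧ 0 < y ∧ 0 < z ∧ 0 < k ∧
      (p ^ x + q ^ y = 2 ^ k * r ^ z ∨ p ^ x + 2 ^ k * r ^ z = q ^ y ∨
        q ^ y + 2 ^ k * r ^ z = p ^ x) ∧
      ∏ s ∈ (a * b * c).primeFactors, (a * b * c).factorization s = x * y * z * k ∧
      rad a b c = 2 * p * q * r := by
  obtain ⟨ℓ, P, Q, hℓ, hP, hQ, hℓ2, hP2, hQ2, hℓP, hℓQ, hPQ, hℓa, hPb, hQc, hpf⟩ :=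
    decisivePrimeBootstrap_shape h hcard hface
  obtain ⟨ha, hb, hsum, hcop⟩ := id h
  have hac : a.Coprime c := Pasten.coprime_left_of_isABCTriple h
  have hbc : b.Coprime c := Pasten.coprime_right_of_isABCTriple h
  have hc : 0 < c := by omega
  have h0 : a * b * c ≠ 0 := by positivity
  -- each odd prime divides exactly one member
  have hℓb : ¬ ℓ ∣ b := decisivePrimeBootstrap_not_dvd_of_coprime hℓ hcop hℓa
  have hℓc : ¬ ℓ ∣ c := decisivePrimeBootstrap_not_dvd_of_coprime hℓ hac hℓa
  have hPa : ¬ P ∣ a := decisivePrimeBootstrap_not_dvd_of_coprime hP hcop.symm hPb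
  have hPc : ¬ P ∣ c := decisivePrimeBootstrap_not_dvd_of_coprime hP hbc hPb
  have hQa : ¬ Q ∣ a := decisivePrimeBootstrap_not_dvd_of_coprime hQ hac.symm hQc
  have hQb : ¬ Q ∣ b := decisivePrimeBootstrap_not_dvd_of_coprime hQ hbc.symm hQc
  have hmem : ∀ s ∈ (a * b * c).primeFactors, s = 2 ∨ s = ℓ ∨ s = P ∨ s = Q := by
    intro s hs
    rw [hpf] at hs
    simpa only [Finset.mem_insert, Finset.mem_singleton] using hs
  -- each member is `2^{v₂} · (its odd prime)^{v}`
  have hrepa : a = 2 ^ a.factorization 2 * ℓ ^ a.factorization ℓ :=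
    decisivePrimeBootstrap_member_eq ha.ne' h0 ⟨b * c, mul_assoc a b c⟩ hℓ2.symm hmem hPa hQa
  have hrepb : b = 2 ^ b.factorization 2 * P ^ b.factorization P :=
    decisivePrimeBootstrap_member_eq hb.ne' h0 ⟨a * c, by ring⟩ hP2.symm
      (fun s hs => by have := hmem s hs; omega) hℓb hQb
  have hrepc : c = 2 ^ c.factorization 2 * Q ^ c.factorization Q :=
    decisivePrimeBootstrap_member_eq hc.ne' h0 ⟨a * b, by ring⟩ hQ2.symm
      (fun s hs => by have := hmem s hs; omega) hℓc hPc
  -- the valuation product and the radical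
  have hprod : ∏ s ∈ (a * b * c).primeFactors, (a * b * c).factorization s =
      (a.factorization 2 + b.factorization 2 + c.factorization 2) * a.factorization ℓ *
        b.factorization P * c.factorization Q :=
    decisivePrimeBootstrap_prod_factorization_eq ha.ne' hb.ne' hc.ne' hpf hℓ2.symm hP2.symm
      hQ2.symm hℓP hℓQ hPQ hℓb hℓc hPa hPc hQa hQb
  have hrad : rad a b c = 2 * ℓ * P * Q := nonface_rad_eq hpf hℓ2 hP2 hQ2 hℓP hℓQ hPQ
  -- the odd exponents are positive, the primes odd
  have hx : 0 < a.factorization ℓ := hℓ.factorization_pos_of_dvd ha.ne' hℓa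
  have hy : 0 < b.factorization P := hP.factorization_pos_of_dvd hb.ne' hPb
  have hz : 0 < c.factorization Q := hQ.factorization_pos_of_dvd hc.ne' hQc
  have hoℓ : Odd ℓ := hℓ.odd_of_ne_two hℓ2
  have hoP : Odd P := hP.odd_of_ne_two hP2
  have hoQ : Odd Q := hQ.odd_of_ne_two hQ2
  -- exactly one member is even
  by_cases h2a : 2 ∣ a
  · -- `a = 2^k ℓ^x` even, `b = P^y`, `c = Q^z`:  `P^y + 2^k ℓ^x = Q^z` (third shape)
    have h2b : ¬ 2 ∣ b := decisivePrimeBootstrap_not_dvd_of_coprime Nat.prime_two hcop h2a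
    have h2c : ¬ 2 ∣ c := decisivePrimeBootstrap_not_dvd_of_coprime Nat.prime_two hac h2a
    have hk : 0 < a.factorization 2 := Nat.prime_two.factorization_pos_of_dvd ha.ne' h2a
    have h2b0 : b.factorization 2 = 0 := Nat.factorization_eq_zero_of_not_dvd h2b
    have h2c0 : c.factorization 2 = 0 := Nat.factorization_eq_zero_of_not_dvd h2c
    rw [h2b0, pow_zero, one_mul] at hrepb
    rw [h2c0, pow_zero, one_mul] at hrepc
    refine ⟨Q, P, ℓ, c.factorization Q, b.factorization P, a.factorization ℓ, a.factorization 2,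
      hQ, hP, hℓ, hoQ, hoP, hoℓ, hPQ.symm, hℓQ.symm, hℓP.symm, hz, hy, hx, hk,
      Or.inr (Or.inr ?_), ?_, ?_⟩
    · rw [hrepa, hrepb, hrepc] at hsum
      omega
    · rw [hprod, h2b0, h2c0]
      ring
    · rw [hrad]
      ring
  by_cases h2b : 2 ∣ b
  · -- `a = ℓ^x`, `b = 2^k P^y` even, `c = Q^z`:  `ℓ^x + 2^k P^y = Q^z` (second shape)
    have h2c : ¬ 2 ∣ c := decisivePrimeBootstrap_not_dvd_of_coprime Nat.prime_two hbc h2b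
    have hk : 0 < b.factorization 2 := Nat.prime_two.factorization_pos_of_dvd hb.ne' h2b
    have h2a0 : a.factorization 2 = 0 := Nat.factorization_eq_zero_of_not_dvd h2a
    have h2c0 : c.factorization 2 = 0 := Nat.factorization_eq_zero_of_not_dvd h2c
    rw [h2a0, pow_zero, one_mul] at hrepa
    rw [h2c0, pow_zero, one_mul] at hrepc
    refine ⟨ℓ, Q, P, a.factorization ℓ, c.factorization Q, b.factorization P, b.factorization 2,
      hℓ, hQ, hP, hoℓ, hoQ, hoP, hℓQ, hℓP, hPQ.symm, hx, hz, hy, hk,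
      Or.inr (Or.inl ?_), ?_, ?_⟩
    · rw [hrepa, hrepb, hrepc] at hsum
      omega
    · rw [hprod, h2a0, h2c0]
      ring
    · rw [hrad]
      ring
  · -- `a = ℓ^x`, `b = P^y`, `c = 2^k Q^z` even:  `ℓ^x + P^y = 2^k Q^z` (first shape)
    have h2c : 2 ∣ c := by omega
    have hk : 0 < c.factorization 2 := Nat.prime_two.factorization_pos_of_dvd hc.ne' h2c
    have h2a0 : a.factorization 2 = 0 := Nat.factorization_eq_zero_of_not_dvd h2a
    have h2b0 : b.factorization 2 = 0 := Nat.factorization_eq_zero_of_not_dvd h2b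
    rw [h2a0, pow_zero, one_mul] at hrepa
    rw [h2b0, pow_zero, one_mul] at hrepb
    refine ⟨ℓ, P, Q, a.factorization ℓ, b.factorization P, c.factorization Q, c.factorization 2,
      hℓ, hP, hQ, hoℓ, hoP, hoQ, hℓP, hℓQ, hPQ, hx, hy, hz, hk, Or.inl ?_, ?_, hrad⟩
    · rw [hrepa, hrepb, hrepc] at hsum
      omega
    · rw [hprod, h2a0, h2b0]
      ring

/-! ## The registered stub -/

/-- **Stub `stub_nonfaceOfHardCore` of the line `matveev-face-clearing` — non-face triples from
the hard core.** If every solution of `p^x + q^y = 2^k r^z`, `p^x + 2^k r^z = q^y` or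
`q^y + 2^k r^z = p^x` in pairwise distinct odd primes `p, q, r` and exponents `x, y, z, k ≥ 1`
satisfies `x·y·z·k ≤ C_ε (2pqr)^ε`, then every abc triple supported on `≤ 4` primes, no member
of which is a power of two, satisfies `∏_{p ∣ abc} v_p(abc) ≤ C_ε rad(abc)^ε`: by
`nonface_hardCore_shape` such a triple is a hard-core solution with
`∏_{p ∣ abc} v_p(abc) = x·y·z·k` and `rad(abc) = 2pqr`. `[folklore]` -/
theorem stub_nonfaceOfHardCore :
    (∀ ε : ℝ, 0 < ε → ∃ C : ℝ, ∀ p q r x y z k : ℕ, p.Prime → q.Prime → r.Prime →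
      Odd p → Odd q → Odd r → p ≠ q → p ≠ r → q ≠ r → 0 < x → 0 < y → 0 < z → 0 < k →
      (p ^ x + q ^ y = 2 ^ k * r ^ z ∨ p ^ x + 2 ^ k * r ^ z = q ^ y ∨
        q ^ y + 2 ^ k * r ^ z = p ^ x) →
      ((x * y * z * k : ℕ) : ℝ) ≤ C * ((2 * p * q * r : ℕ) : ℝ) ^ ε) →
    ∀ ε : ℝ, 0 < ε → ∃ C : ℝ, ∀ a b c : ℕ,
      Literature.NumberTheory.DiophantineGeometry.IsABCTriple a b c →
      (a * b * c).primeFactors.card ≤ 4 →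
      ¬ ((∃ j : ℕ, a = 2 ^ j) ∨ (∃ j : ℕ, b = 2 ^ j) ∨ (∃ j : ℕ, c = 2 ^ j)) →
      ((∏ p ∈ (a * b * c).primeFactors, (a * b * c).factorization p : ℕ) : ℝ) ≤
        C * (Literature.NumberTheory.DiophantineGeometry.rad a b c : ℝ) ^ ε := by
  intro hH ε hε
  obtain ⟨C, hC⟩ := hH ε hε
  refine ⟨C, fun a b c h hcard hface => ?_⟩
  obtain ⟨p, q, r, x, y, z, k, hp, hq, hr, hop, hoq, hor, hpq, hpr, hqr, hx, hy, hz, hk, hsol,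
    hprod, hrad⟩ := nonface_hardCore_shape h hcard hface
  rw [hprod, hrad]
  exact hC p q r x y z k hp hq hr hop hoq hor hpq hpr hqr hx hy hz hk hsol

end Summit.ABC.ABC.Theorems.FewPrimeValuationProduct

end
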